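import Summits.ABC.IUTFork.Conditional.AbcOfSOrNumK
import Summits.ABC.IUTFork.LDHGenuinePerImageContentfulBIII
import HarnessLib

/-!
# Branch C, K line — the STABLE COMPANION OF RECORD with its CONE binder CUT TO THE SZPIRO-BAD LOCUS: `hreg ↦ hregBad`
# (C-lead ruling C-R28 (3) option (α); explicit 2 = `hNumOffBad` · `hregBad`; at every Szpiro-good admissible `(P, l)` NOTHING is assumed)

C scoreboard (abc-iut-C-cert-2 gen 3, ODD-revision writer; C-lead rulings C-R27 (1)(b) / C-R28 (3) «hreg REPAIR MENU», option (α)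
«hreg ↦ hregBad», and C-R31 (STABLE COMPANION OF RECORD = abc-iut-C-cert-3's `Conditional.abc_of_SH_orNum_K_szpiroBad`, p451044)).
PROOF-ONLY (no `def`, no new `Prop`, no instance, no notation; nothing re-typed).

CONTEXT. Every K-line certificate of record (`abc_of_SH_v10K_window_szpiroBad` p449402, the double cut p450130, the stable companion
p451044) carries ONE binder in common, the CONE binder `hreg`: «at EVERY admissible `(P, l)` and every genuine datum `T` whose local
`log q` contributions are NOT slot-constant, `T.HullEstimateOf (B_III(P,l))`» — print's [IUTchIV] Thm. 1.10 Step (v) bound for the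
hull in reading (U). The tail `Summit.ABC.ABC.Theorems.ThetaPartII.ABC_of_cor312_of_hullRegime` (abc-iut-c312-8) consumes it at EVERY
admissible point. `hreg` is under filed attack AS TYPED at admissible `d_mod = 2` data (abc-iut-s2-p5 «HVOL-REFUTATION-QUADWITNESS»,
abc-iut-C-cert-1 «HVOL-KERNEL»: the quadratic witness family with the mixed prime `7`, where a refutation can only use the trivial UPPER
bound `log-cond ≤ O(height)`). C-R28 (3)(α) asks whether the tail can be fed the SZPIRO-GOOD case WITHOUT the hull regime. IT CAN, from
landed theorems only: at a Szpiro-good admissible `(P, l)` (`d_mod ≤ (l+5)/4` and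
`log q^{∤2l} ≤ (6l(l+5−4d_mod)/((l+4)(l−3)))·(log-diff + (1−1/l)·log-cond) + (6l(l+5)/((l+4)(l−3)))·log π`) abc-iut-c312-d1's
`Cor22.cor312PerImageAtDatum_of_szpiro` (p449008) gives the PER-IMAGE Corollary at `(P, l)`, and abc-iut-c312-d1's
`PointDict.gap_le_BIII_of_cor312PerImageAtDatum` (p448494; the per-image hull estimate with `B_III` is abc-iut-S3's PINNED junction, a
theorem at every datum, (R4) by `T.R4_towerFact`) turns it into [IUTchIV] Thm. 1.10 Step (viii)'s squeeze
`κ_l·log q^{∤2l}(λ) ≤ B_III(P,l) + ((l+5)/4)·log π` — NO hull-regime input. At a Szpiro-BAD admissible `(P, l)` the route is the stable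
companion's: per datum, OUR typed (xi-f) licence holds ⇒ abc-iut-C-cert-3's `GenuineK.cor312Of_of_SH` (Θ-READ a theorem, abc-iut-s2-p6
p447368), fails ⇒ `hNumOffBad`; the hull estimate ON the slot-constant regime is abc-iut-S3's `PointDict.hullEstimateOf_BIII_pinned`
((R4) = abc-iut-S1's `ThetaPartII.stub_R4`), OFF it `hregBad`; squeeze `PointDict.logQAvoid_le_of_cor312AtDatum` (abc-iut-S2). Both
branches land in abc-iut-S-d2's `ThetaPartIIDisplay.ThetaPartII_of_squeezeIII`, then the route's `IUTThetaPilot.closes` with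
`genEllTwo_holds` (abc-iut-S6) and `JInvWlog_proof`:

* **`abc_of_SH_orNum_K_szpiroBad_hregBad`** — DATA and `hNumOffBad` = p451044's VERBATIM; `hregBad` := p451044's `hreg` with the SAME
  Szpiro-bad antecedent as `hNumOffBad` inserted (text diff = that antecedent only). Explicit 2 = NUM-OFF(Szpiro-bad) 1 · CONE(Szpiro-bad) 1;
  at every Szpiro-GOOD admissible `(P, l)` NO hypothesis of any kind is consumed.
  p451044's `hreg` implies `hregBad` by dropping the antecedent, so the new certificate is WEAKER-OR-EQUAL binder by binder (C-R2).

WHY THE QUADRATIC WITNESS CANNOT BE REPLAYED AGAINST `hregBad` (scope sentence, nothing asserted about the family): a refutation of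
`hregBad` needs an admissible datum that is BOTH non-slot-constant with hull volume above `B_III` AND Szpiro-bad, i.e. with
`log q^{∤2l} > (6 − O(d_mod/l))·(log-diff + log-cond)`; certifying the second conjunct for an explicit point requires a LOWER bound on
`log q` against the conductor — an abc-near-extremal point — whereas the filed refutations of `hreg` use only `log-cond ≤ O(height)`.
HONEST STRENGTH: `hregBad` is demanded exactly at would-be Szpiro-violating admissible points (none is known; under abc there is none
for large `l`), like `hNumOffBad` (C-R28 (2)); it is neither proved nor refuted as typed; closing it in the kernel at those points is
VERDICT RISK ¶7 (absorption of the (Ind1) slot residue by `B_III`). HONEST FRAMING: locates / conditionally verifies; nothing here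
asserts that abc is proved or refuted, or that [IUTchIII] Cor. 3.12 / Thm. 3.11 or [IUTchIV] Thm. 1.10 holds or fails at any datum, or
takes a side on any author (Mochizuki / Scholze–Stix / Joshi / Dupuy–Hilado); `hNumOffBad` / `hregBad` are assumption labels, never
asserted; SHARP reading (U); typed ≠ proved; instantiated ≠ endorsed; refuted-as-typed ≠ refuted-in-print. [claim: Mochizuki2012, status: disputed]
[cite: Mochizuki2012, IUTchIII Cor. 3.12 p. 173–174, Step (xi-f) p. 184; IUTchIV Thm. 1.10 p. 22–31 (Steps (v) p. 27–28, (viii) p. 30),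
Cor. 2.2 (ii)–(iii) p. 43–47]
-/

noncomputable section

open Set Function NumberField IsDedekindDomain

namespace Summit.ABC.IUTFork.Conditional

open Thm311 Thm311.Real Cor312 Cor312Vol Cor312Prov Literature.IUT.LogThetaLattice Literature.IUT.LogVolume
  Literature.IUT.HodgeTheaters Literature.IUT.LogVolume.ThetaData
open Literature.NumberTheory.DiophantineGeometry.GenEll Summit.ABC.ABC.Theorems

/-- **`abc_of_SH_orNum_K_szpiroBad_hregBad`** — `ABC` from, per admissible SZPIRO-BAD `(P, l)` and genuine datum `T`: «if OUR typed
(xi-f) licence FAILS at the chosen realising ideles / pinned reading, then the number-level Corollary `T.Cor312Of`» (`hNumOffBad`,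
abc-iut-C-cert-3 p451044 VERBATIM) and «if `T` is not slot-constant, the hull estimate `T.HullEstimateOf (B_III(P,l))`» (`hregBad` =
p451044's `hreg` restricted to the Szpiro-bad locus). Explicit 2; at every Szpiro-good admissible point nothing is assumed
(abc-iut-c312-d1 p449008 / p448494). «`ABC` follows from these hypotheses as typed» — no side taken on [IUTchIII] Cor. 3.12 or
[IUTchIV] Thm. 1.10; typed ≠ proved; instantiated ≠ endorsed. [claim: Mochizuki2012, status: disputed]
[cite: Mochizuki2012, IUTchIV Thm. 1.10 Step (viii) p. 30] -/
theorem abc_of_SH_orNum_K_szpiroBad_hregBad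
    (M : ∀ (P : NFPoint) (l : ℕ) (T : Cor22.ThetaVolumeDatumAt P l), Type) [∀ P l T, Field (M P l T)] [∀ P l T, NumberField (M P l T)]
    (archPk : ∀ (P : NFPoint) (l : ℕ) (T : Cor22.ThetaVolumeDatumAt P l), letI := T.instFieldF; letI := T.instNumberFieldF; letI := T.instAlgebraF; letI := T.instFieldK;
        letI := T.instNumberFieldK; letI := T.instAlgebraK; letI := T.instFieldFbar; letI := T.instAlgebraFbar;
        letI := T.instAlgebraKFbar; letI := T.instIsElliptic;
      ∀ (j : (thetaIndex (pilotDataOfK T.D T.K)).Label) (vQ : (thetaIndex (pilotDataOfK T.D T.K)).VQ), Set ((logShellsDH (pilotDataOfK T.D T.K) (analyticLogv T.K)).Packet j vQ))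
    (archSub : ∀ (P : NFPoint) (l : ℕ) (T : Cor22.ThetaVolumeDatumAt P l), letI := T.instFieldF; letI := T.instNumberFieldF; letI := T.instAlgebraF; letI := T.instFieldK;
        letI := T.instNumberFieldK; letI := T.instAlgebraK; letI := T.instFieldFbar; letI := T.instAlgebraFbar;
        letI := T.instAlgebraKFbar; letI := T.instIsElliptic;
      ∀ (j : (thetaIndex (pilotDataOfK T.D T.K)).Label) (v : (thetaIndex (pilotDataOfK T.D T.K)).V), Set ((logShellsDH (pilotDataOfK T.D T.K) (analyticLogv T.K)).Packet j ((thetaIndex (pilotDataOfK T.D T.K)).over v)))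
    (Ψ : ∀ (P : NFPoint) (l : ℕ) (T : Cor22.ThetaVolumeDatumAt P l), letI := T.instFieldF; letI := T.instNumberFieldF; letI := T.instAlgebraF; letI := T.instFieldK;
        letI := T.instNumberFieldK; letI := T.instAlgebraK; letI := T.instFieldFbar; letI := T.instAlgebraFbar;
        letI := T.instAlgebraKFbar; letI := T.instIsElliptic;
      ℤ → ∀ v : (thetaIndex (pilotDataOfK T.D T.K)).V, v ∈ (thetaIndex (pilotDataOfK T.D T.K)).Vbad → Set ((logShellsDH (pilotDataOfK T.D T.K) (analyticLogv T.K)).StarPacket v))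
    (act : ∀ (P : NFPoint) (l : ℕ) (T : Cor22.ThetaVolumeDatumAt P l), letI := T.instFieldF; letI := T.instNumberFieldF; letI := T.instAlgebraF; letI := T.instFieldK;
        letI := T.instNumberFieldK; letI := T.instAlgebraK; letI := T.instFieldFbar; letI := T.instAlgebraFbar;
        letI := T.instAlgebraKFbar; letI := T.instIsElliptic;
      ℤ → ∀ v : (thetaIndex (pilotDataOfK T.D T.K)).V, v ∈ (thetaIndex (pilotDataOfK T.D T.K)).Vbad → (logShellsDH (pilotDataOfK T.D T.K) (analyticLogv T.K)).StarPacket v → Module.End ℚ ((logShellsDH (pilotDataOfK T.D T.K) (analyticLogv T.K)).StarPacket v))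
    (Mmod : ∀ (P : NFPoint) (l : ℕ) (T : Cor22.ThetaVolumeDatumAt P l), letI := T.instFieldF; letI := T.instNumberFieldF; letI := T.instAlgebraF; letI := T.instFieldK;
        letI := T.instNumberFieldK; letI := T.instAlgebraK; letI := T.instFieldFbar; letI := T.instAlgebraFbar;
        letI := T.instAlgebraKFbar; letI := T.instIsElliptic;
      ℤ → ∀ j : (thetaIndex (pilotDataOfK T.D T.K)).LabelStar, Set ((logShellsDH (pilotDataOfK T.D T.K) (analyticLogv T.K)).GlobalPacket j.1))
    (region : ∀ (P : NFPoint) (l : ℕ) (T : Cor22.ThetaVolumeDatumAt P l), letI := T.instFieldF; letI := T.instNumberFieldF; letI := T.instAlgebraF; letI := T.instFieldK;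
        letI := T.instNumberFieldK; letI := T.instAlgebraK; letI := T.instFieldFbar; letI := T.instAlgebraFbar;
        letI := T.instAlgebraKFbar; letI := T.instIsElliptic;
      ℤ → ∀ j : (thetaIndex (pilotDataOfK T.D T.K)).LabelStar, FinDivisor (M P l T) → ∀ vQ : (thetaIndex (pilotDataOfK T.D T.K)).VQ, Set ((logShellsDH (pilotDataOfK T.D T.K) (analyticLogv T.K)).Packet j.1 vQ))
    (frobAdm : ∀ (P : NFPoint) (l : ℕ) (T : Cor22.ThetaVolumeDatumAt P l), letI := T.instFieldF; letI := T.instNumberFieldF; letI := T.instAlgebraF; letI := T.instFieldK;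
        letI := T.instNumberFieldK; letI := T.instAlgebraK; letI := T.instFieldFbar; letI := T.instAlgebraFbar;
        letI := T.instAlgebraKFbar; letI := T.instIsElliptic;
      ℤ → ℤ → ∀ (j : (thetaIndex (pilotDataOfK T.D T.K)).Label) (vQ : (thetaIndex (pilotDataOfK T.D T.K)).VQ), Set ((logShellsDH (pilotDataOfK T.D T.K) (analyticLogv T.K)).Packet j vQ) → Prop)
    (frobLogvol : ∀ (P : NFPoint) (l : ℕ) (T : Cor22.ThetaVolumeDatumAt P l), letI := T.instFieldF; letI := T.instNumberFieldF; letI := T.instAlgebraF; letI := T.instFieldK;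
        letI := T.instNumberFieldK; letI := T.instAlgebraK; letI := T.instFieldFbar; letI := T.instAlgebraFbar;
        letI := T.instAlgebraKFbar; letI := T.instIsElliptic;
      ℤ → ℤ → ∀ (j : (thetaIndex (pilotDataOfK T.D T.K)).Label) (vQ : (thetaIndex (pilotDataOfK T.D T.K)).VQ), Set ((logShellsDH (pilotDataOfK T.D T.K) (analyticLogv T.K)).Packet j vQ) → ℝ)
    (frobΨ : ∀ (P : NFPoint) (l : ℕ) (T : Cor22.ThetaVolumeDatumAt P l), letI := T.instFieldF; letI := T.instNumberFieldF; letI := T.instAlgebraF; letI := T.instFieldK;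
        letI := T.instNumberFieldK; letI := T.instAlgebraK; letI := T.instFieldFbar; letI := T.instAlgebraFbar;
        letI := T.instAlgebraKFbar; letI := T.instIsElliptic;
      ℤ → ℤ → ∀ v : (thetaIndex (pilotDataOfK T.D T.K)).V, v ∈ (thetaIndex (pilotDataOfK T.D T.K)).Vbad → Set ((logShellsDH (pilotDataOfK T.D T.K) (analyticLogv T.K)).StarPacket v))
    (frobMmod : ∀ (P : NFPoint) (l : ℕ) (T : Cor22.ThetaVolumeDatumAt P l), letI := T.instFieldF; letI := T.instNumberFieldF; letI := T.instAlgebraF; letI := T.instFieldK;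
        letI := T.instNumberFieldK; letI := T.instAlgebraK; letI := T.instFieldFbar; letI := T.instAlgebraFbar;
        letI := T.instAlgebraKFbar; letI := T.instIsElliptic;
      ℤ → ℤ → ∀ j : (thetaIndex (pilotDataOfK T.D T.K)).LabelStar, Set ((logShellsDH (pilotDataOfK T.D T.K) (analyticLogv T.K)).GlobalPacket j.1))
    (unitImage : ∀ (P : NFPoint) (l : ℕ) (T : Cor22.ThetaVolumeDatumAt P l), letI := T.instFieldF; letI := T.instNumberFieldF; letI := T.instAlgebraF; letI := T.instFieldK;
        letI := T.instNumberFieldK; letI := T.instAlgebraK; letI := T.instFieldFbar; letI := T.instAlgebraFbar;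
        letI := T.instAlgebraKFbar; letI := T.instIsElliptic;
      ℤ → ℤ → ℕ → ∀ (j : (thetaIndex (pilotDataOfK T.D T.K)).Label) (vQ : (thetaIndex (pilotDataOfK T.D T.K)).VQ), Set ((logShellsDH (pilotDataOfK T.D T.K) (analyticLogv T.K)).Packet j vQ))
    (ballImage : ∀ (P : NFPoint) (l : ℕ) (T : Cor22.ThetaVolumeDatumAt P l), letI := T.instFieldF; letI := T.instNumberFieldF; letI := T.instAlgebraF; letI := T.instFieldK;
        letI := T.instNumberFieldK; letI := T.instAlgebraK; letI := T.instFieldFbar; letI := T.instAlgebraFbar;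
        letI := T.instAlgebraKFbar; letI := T.instIsElliptic;
      ℤ → ℤ → ∀ (j : (thetaIndex (pilotDataOfK T.D T.K)).Label) (vQ : (thetaIndex (pilotDataOfK T.D T.K)).VQ), Set ((logShellsDH (pilotDataOfK T.D T.K) (analyticLogv T.K)).Packet j vQ))
    (thetaDiv : ∀ (P : NFPoint) (l : ℕ) (T : Cor22.ThetaVolumeDatumAt P l), letI := T.instFieldF; letI := T.instNumberFieldF; letI := T.instAlgebraF; letI := T.instFieldK;
        letI := T.instNumberFieldK; letI := T.instAlgebraK; letI := T.instFieldFbar; letI := T.instAlgebraFbar;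
        letI := T.instAlgebraKFbar; letI := T.instIsElliptic;
      ℤ → ℤ → LgpDivisor (M P l T) (thetaIndex (pilotDataOfK T.D T.K)).lstar)
    (n : ∀ (P : NFPoint) (l : ℕ) (T : Cor22.ThetaVolumeDatumAt P l), ℤ)
    {HT : ∀ (P : NFPoint) (l : ℕ) (T : Cor22.ThetaVolumeDatumAt P l), Type} {LogLink : ∀ (P : NFPoint) (l : ℕ) (T : Cor22.ThetaVolumeDatumAt P l), HT P l T → HT P l T → Type}
    {IsFull : ∀ (P : NFPoint) (l : ℕ) (T : Cor22.ThetaVolumeDatumAt P l), ∀ {s t : HT P l T}, LogLink P l T s t → Prop}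
    (lat : ∀ (P : NFPoint) (l : ℕ) (T : Cor22.ThetaVolumeDatumAt P l), LGPGaussianLogThetaLattice (LogLink P l T) (IsFull P l T))
    {Frd : ∀ (P : NFPoint) (l : ℕ) (T : Cor22.ThetaVolumeDatumAt P l), Type} {IsoF : ∀ (P : NFPoint) (l : ℕ) (T : Cor22.ThetaVolumeDatumAt P l), Frd P l T → Frd P l T → Type} {Ob : ∀ (P : NFPoint) (l : ℕ) (T : Cor22.ThetaVolumeDatumAt P l), Frd P l T → Type}
    {realify : ∀ (P : NFPoint) (l : ℕ) (T : Cor22.ThetaVolumeDatumAt P l), Frd P l T → Frd P l T} {Strip : ∀ (P : NFPoint) (l : ℕ) (T : Cor22.ThetaVolumeDatumAt P l), Type} {IsoS : ∀ (P : NFPoint) (l : ℕ) (T : Cor22.ThetaVolumeDatumAt P l), Strip P l T → Strip P l T → Type}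
    {Mv : ∀ (P : NFPoint) (l : ℕ) (T : Cor22.ThetaVolumeDatumAt P l), letI := T.instFieldF; letI := T.instNumberFieldF; letI := T.instAlgebraF; letI := T.instFieldK;
        letI := T.instNumberFieldK; letI := T.instAlgebraK; letI := T.instFieldFbar; letI := T.instAlgebraFbar;
        letI := T.instAlgebraKFbar; letI := T.instIsElliptic;
      ∀ v : (thetaIndex (pilotDataOfK T.D T.K)).V, v ∈ (thetaIndex (pilotDataOfK T.D T.K)).Vbad → Type}
    [∀ P l T v h, Monoid (Mv P l T v h)]
    (sig : ∀ (P : NFPoint) (l : ℕ) (T : Cor22.ThetaVolumeDatumAt P l), letI := T.instFieldF; letI := T.instNumberFieldF; letI := T.instAlgebraF; letI := T.instFieldK;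
        letI := T.instNumberFieldK; letI := T.instAlgebraK; letI := T.instFieldFbar; letI := T.instAlgebraFbar;
        letI := T.instAlgebraKFbar; letI := T.instIsElliptic;
      GlobalLGPFrobenioidSignature (thetaIndex (pilotDataOfK T.D T.K)).lstar (thetaIndex (pilotDataOfK T.D T.K)).V (· ∈ (thetaIndex (pilotDataOfK T.D T.K)).Vbad) (Frd P l T) (IsoF P l T) (Ob P l T) (realify P l T)
        (Strip P l T) (IsoS P l T) (Mv P l T))
    (split : ∀ (P : NFPoint) (l : ℕ) (T : Cor22.ThetaVolumeDatumAt P l), SplittingMonoids (Mv P l T))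
    {ObΔ : ∀ (P : NFPoint) (l : ℕ) (T : Cor22.ThetaVolumeDatumAt P l), Type} {N : ∀ (P : NFPoint) (l : ℕ) (T : Cor22.ThetaVolumeDatumAt P l), letI := T.instFieldF; letI := T.instNumberFieldF; letI := T.instAlgebraF; letI := T.instFieldK;
        letI := T.instNumberFieldK; letI := T.instAlgebraK; letI := T.instFieldFbar; letI := T.instAlgebraFbar;
        letI := T.instAlgebraKFbar; letI := T.instIsElliptic;
      ∀ v : (thetaIndex (pilotDataOfK T.D T.K)).V, v ∈ (thetaIndex (pilotDataOfK T.D T.K)).Vbad → Type}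
    [∀ P l T v h, Monoid (N P l T v h)] (qData : ∀ (P : NFPoint) (l : ℕ) (T : Cor22.ThetaVolumeDatumAt P l), QPilotData (ObΔ P l T) (N P l T))
    (qK : ∀ (P : NFPoint) (l : ℕ) (T : Cor22.ThetaVolumeDatumAt P l), letI := T.instFieldF; letI := T.instNumberFieldF; letI := T.instAlgebraF; letI := T.instFieldK;
        letI := T.instNumberFieldK; letI := T.instAlgebraK; letI := T.instFieldFbar; letI := T.instAlgebraFbar;
        letI := T.instAlgebraKFbar; letI := T.instIsElliptic;
      ∀ v : (thetaIndex (pilotDataOfK T.D T.K)).V, v ∈ (thetaIndex (pilotDataOfK T.D T.K)).Vbad → Set ((logShellsDH (pilotDataOfK T.D T.K) (analyticLogv T.K)).StarPacket v))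
    (hNumOffBad : ∀ (P : NFPoint), P ∈ UP → ∀ (l : ℕ), l.Prime → 5 ≤ l →
      Cor22.AdmitsCore P → Cor22.CondP2 P l → Cor22.CondP5 P l → Cor22.CondP6 P l →
      -- ONLY at SZPIRO-BAD `(P, l)` (abc-iut-c312-d1 `Cor22.forall_cor312Of_of_szpiroBad`): off this locus `T.Cor312Of` is a kernel theorem
      (((l : ℝ) + 5) / 4 < (Cor22.dmod P : ℝ) ∨
        6 * l * (((l : ℝ) + 5) - 4 * Cor22.dmod P) / (((l : ℝ) + 4) * ((l : ℝ) - 3))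
            * (P.logDiff + (1 - 1 / (l : ℝ)) * Cor22.logCondAvoid P {2, l})
          + 6 * l * ((l : ℝ) + 5) / (((l : ℝ) + 4) * ((l : ℝ) - 3)) * Real.log Real.pi < Cor22.logQAvoid P {2, l}) →
      ∀ (T : Cor22.ThetaVolumeDatumAt P l), letI := T.instFieldF; letI := T.instNumberFieldF; letI := T.instAlgebraF; letI := T.instFieldK;
        letI := T.instNumberFieldK; letI := T.instAlgebraK; letI := T.instFieldFbar; letI := T.instAlgebraFbar;
        letI := T.instAlgebraKFbar; letI := T.instIsElliptic;
      -- … and ONLY where OUR typed licence FAILS at the chosen ideles / pinned reading: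
      ¬ (Cor312Vol.PilotKummerCompatHull
        (LatticeSituation.ofShells (logShellsDH (pilotDataOfK T.D T.K) (analyticLogv T.K)) (M P l T) (archPk P l T)
          (archSub P l T) (summandPiecesPr (pilotDataOfK T.D T.K) (logvAnalytic_analyticLogv (F := T.K))).Adm
          (summandPiecesPr (pilotDataOfK T.D T.K) (logvAnalytic_analyticLogv (F := T.K))).logvol (Ψ P l T) (act P l T) (Mmod P l T)
          (region P l T) (frobAdm P l T) (frobLogvol P l T) (frobΨ P l T) (frobMmod P l T) (unitImage P l T)
          (ballImage P l T) (thetaDiv P l T))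
        (settingPrVolSharp (pilotDataOfK T.D T.K) (logvAnalytic_analyticLogv (F := T.K)) (M P l T) (archPk P l T) (archSub P l T) (Ψ P l T)
          (act P l T) (Mmod P l T) (region P l T) (n P l T) (lat P l T) (sig P l T) (split P l T) (qData P l T)
          (exists_realising_qIdeles_pilotDataOfK T.D).choose
          (exists_realising_thetaIdeles_pilotDataOfK T.D).choose
          (exists_realising_qIdeles_pilotDataOfK T.D).choose_spec.1
          (exists_realising_qIdeles_pilotDataOfK T.D).choose_spec.2.1)
        (fun _ => Cor312.Setting.qRegion
        (settingPrVolSharp (pilotDataOfK T.D T.K) (logvAnalytic_analyticLogv (F := T.K)) (M P l T) (archPk P l T) (archSub P l T) (Ψ P l T)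
          (act P l T) (Mmod P l T) (region P l T) (n P l T) (lat P l T) (sig P l T) (split P l T) (qData P l T)
          (exists_realising_qIdeles_pilotDataOfK T.D).choose
          (exists_realising_thetaIdeles_pilotDataOfK T.D).choose
          (exists_realising_qIdeles_pilotDataOfK T.D).choose_spec.1
          (exists_realising_qIdeles_pilotDataOfK T.D).choose_spec.2.1)) (qK P l T)) → T.Cor312Of)
    -- [CONE, Szpiro-bad] the off-regime hull estimate with print's constant `B_III(P,l)`, demanded ONLY at SZPIRO-BAD admissible `(P, l)`
    (hregBad : ∀ P : NFPoint, P ∈ UP → ∀ l : ℕ, l.Prime → 5 ≤ l →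
      Cor22.AdmitsCore P → Cor22.CondP2 P l → Cor22.CondP5 P l → Cor22.CondP6 P l →
      (((l : ℝ) + 5) / 4 < (Cor22.dmod P : ℝ) ∨
        6 * l * (((l : ℝ) + 5) - 4 * Cor22.dmod P) / (((l : ℝ) + 4) * ((l : ℝ) - 3))
            * (P.logDiff + (1 - 1 / (l : ℝ)) * Cor22.logCondAvoid P {2, l})
          + 6 * l * ((l : ℝ) + 5) / (((l : ℝ) + 4) * ((l : ℝ) - 3)) * Real.log Real.pi < Cor22.logQAvoid P {2, l}) →
      ∀ T : Cor22.ThetaVolumeDatumAt P l,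
        (letI := T.instFieldF; letI := T.instNumberFieldF; letI := T.instAlgebraF; letI := T.instFieldK
         letI := T.instNumberFieldK; letI := T.instAlgebraK; letI := T.instFieldFbar; letI := T.instAlgebraFbar
         letI := T.instAlgebraKFbar; letI := T.instIsElliptic
         ¬ (∀ p ∈ T.I.supportPrimes, ∀ v w : placesOver (fieldOfModuli T.E) p,
            (Summit.ABC.IUTFork.DHData.ofInput T.I).logQloc p v = (Summit.ABC.IUTFork.DHData.ofInput T.I).logQloc p w)) →
        T.HullEstimateOf
          (((l : ℝ) + 1) / 4 *
            ((1 + 12 * (Cor22.dmod P : ℝ) / l) * (P.logDiff + Cor22.logCondAvoid P {2, l})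
              + 2 * Real.log l + 52
              + 20 / 3 * Real.log (((2 ^ 12 * 3 ^ 3 * 5 * Cor22.dmod P : ℕ) : ℝ) * (l : ℝ))
                * (Nat.primeCounting (2 ^ 12 * 3 ^ 3 * 5 * Cor22.dmod P * l) : ℝ))))
    : _root_.ABC := by
  refine Summit.ABC.ABC.Theses.IUTThetaPilot.closes
    (ThetaPartIIDisplay.ThetaPartII_of_squeezeIII fun P hP l hl h5 hc h2 h5' h6 => ?_) genEllTwo_holds JInvWlog_proof
  -- a genuine Θ-volume datum exists at the admissible `(P, l)` (abc-iut-L5-t7), and `l ≥ 7` by (P6)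
  obtain ⟨T⟩ := ThetaPartII.stub_thetaData P hP l hl h5 hc h2 h5' h6
  have h7 : 7 ≤ l := ThetaPartII.seven_le_of_condP6 hP hl h5 h6
  -- THE SZPIRO-BAD BRANCH at this `(P, l)`: `Cor22.Cor312AtDatum P l` per datum from the licence (`GenuineK.cor312Of_of_SH`, Θ-READ by
  -- abc-iut-s2-p6 p447368) or `hNumOffBad`; `Cor22.HullVolumeAtDatum P l (B_III)` per datum from the pinned junction (slot-constant,
  -- abc-iut-S3, (R4) abc-iut-S1) or `hregBad`; then abc-iut-S2's squeeze `PointDict.logQAvoid_le_of_cor312AtDatum`.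
  have key : (((l : ℝ) + 5) / 4 < (Cor22.dmod P : ℝ) ∨
        6 * l * (((l : ℝ) + 5) - 4 * Cor22.dmod P) / (((l : ℝ) + 4) * ((l : ℝ) - 3))
            * (P.logDiff + (1 - 1 / (l : ℝ)) * Cor22.logCondAvoid P {2, l})
          + 6 * l * ((l : ℝ) + 5) / (((l : ℝ) + 4) * ((l : ℝ) - 3)) * Real.log Real.pi < Cor22.logQAvoid P {2, l}) →
      (((l : ℝ) + 1) / 24 - 1 / (2 * l)) * Cor22.logQAvoid P {2, l} ≤
        ((l : ℝ) + 1) / 4 *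
          ((1 + 12 * (Cor22.dmod P : ℝ) / l) * (P.logDiff + Cor22.logCondAvoid P {2, l})
            + 2 * Real.log l + 52
            + 20 / 3 * Real.log (((2 ^ 12 * 3 ^ 3 * 5 * Cor22.dmod P : ℕ) : ℝ) * (l : ℝ))
              * (Nat.primeCounting (2 ^ 12 * 3 ^ 3 * 5 * Cor22.dmod P * l) : ℝ))
        + ThetaVolumeInput.archLogTheta l := by
    intro hbad
    have h312 : Cor22.Cor312AtDatum P l := by
      intro T'
      letI := T'.instFieldF; letI := T'.instNumberFieldF; letI := T'.instAlgebraF; letI := T'.instFieldK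
      letI := T'.instNumberFieldK; letI := T'.instAlgebraK; letI := T'.instFieldFbar; letI := T'.instAlgebraFbar
      letI := T'.instAlgebraKFbar; letI := T'.instIsElliptic
      by_cases hS : (Cor312Vol.PilotKummerCompatHull
            (LatticeSituation.ofShells (logShellsDH (pilotDataOfK T'.D T'.K) (analyticLogv T'.K)) (M P l T') (archPk P l T')
              (archSub P l T') (summandPiecesPr (pilotDataOfK T'.D T'.K) (logvAnalytic_analyticLogv (F := T'.K))).Adm
              (summandPiecesPr (pilotDataOfK T'.D T'.K) (logvAnalytic_analyticLogv (F := T'.K))).logvol (Ψ P l T') (act P l T') (Mmod P l T')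
              (region P l T') (frobAdm P l T') (frobLogvol P l T') (frobΨ P l T') (frobMmod P l T') (unitImage P l T')
              (ballImage P l T') (thetaDiv P l T'))
            (settingPrVolSharp (pilotDataOfK T'.D T'.K) (logvAnalytic_analyticLogv (F := T'.K)) (M P l T') (archPk P l T') (archSub P l T') (Ψ P l T')
              (act P l T') (Mmod P l T') (region P l T') (n P l T') (lat P l T') (sig P l T') (split P l T') (qData P l T')
              (exists_realising_qIdeles_pilotDataOfK T'.D).choose
              (exists_realising_thetaIdeles_pilotDataOfK T'.D).choose
              (exists_realising_qIdeles_pilotDataOfK T'.D).choose_spec.1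
              (exists_realising_qIdeles_pilotDataOfK T'.D).choose_spec.2.1)
            (fun _ => Cor312.Setting.qRegion
            (settingPrVolSharp (pilotDataOfK T'.D T'.K) (logvAnalytic_analyticLogv (F := T'.K)) (M P l T') (archPk P l T') (archSub P l T') (Ψ P l T')
              (act P l T') (Mmod P l T') (region P l T') (n P l T') (lat P l T') (sig P l T') (split P l T') (qData P l T')
              (exists_realising_qIdeles_pilotDataOfK T'.D).choose
              (exists_realising_thetaIdeles_pilotDataOfK T'.D).choose
              (exists_realising_qIdeles_pilotDataOfK T'.D).choose_spec.1
              (exists_realising_qIdeles_pilotDataOfK T'.D).choose_spec.2.1)) (qK P l T'))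
      · exact GenuineK.cor312Of_of_SH T'.D T'.K (M P l T') (archPk P l T') (archSub P l T') (Ψ P l T') (act P l T') (Mmod P l T')
          (region P l T') (frobAdm P l T') (frobLogvol P l T') (frobΨ P l T') (frobMmod P l T') (unitImage P l T') (ballImage P l T')
          (thetaDiv P l T') (n P l T') (lat P l T') (sig P l T') (split P l T') (qData P l T')
          (exists_realising_thetaIdeles_pilotDataOfK T'.D).choose (exists_realising_qIdeles_pilotDataOfK T'.D).choose
          (fun _ => Cor312.Setting.qRegion
              (settingPrVolSharp (pilotDataOfK T'.D T'.K) (logvAnalytic_analyticLogv (F := T'.K)) (M P l T') (archPk P l T') (archSub P l T') (Ψ P l T')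
              (act P l T') (Mmod P l T') (region P l T') (n P l T') (lat P l T') (sig P l T') (split P l T') (qData P l T')
              (exists_realising_qIdeles_pilotDataOfK T'.D).choose
              (exists_realising_thetaIdeles_pilotDataOfK T'.D).choose
              (exists_realising_qIdeles_pilotDataOfK T'.D).choose_spec.1
              (exists_realising_qIdeles_pilotDataOfK T'.D).choose_spec.2.1)) (qK P l T')
          T'.isVolumeInputOf (exists_realising_qIdeles_pilotDataOfK T'.D).choose_spec.1
          (exists_realising_qIdeles_pilotDataOfK T'.D).choose_spec.2.1 (exists_realising_thetaIdeles_pilotDataOfK T'.D).choose_spec.1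
          (exists_realising_thetaIdeles_pilotDataOfK T'.D).choose_spec.2.1 (exists_realising_qIdeles_pilotDataOfK T'.D).choose_spec.2.2
          hS (fun _ _ => rfl)
          (negLogTheta_settingPrVolSharp_pilotDataOfK_le_datum T' (M P l T') (archPk P l T') (archSub P l T') (Ψ P l T') (act P l T')
            (Mmod P l T') (region P l T') (n P l T') (lat P l T') (sig P l T') (split P l T') (qData P l T')
            (exists_realising_qIdeles_pilotDataOfK T'.D).choose (exists_realising_thetaIdeles_pilotDataOfK T'.D).choose
            (exists_realising_qIdeles_pilotDataOfK T'.D).choose_spec.1 (exists_realising_qIdeles_pilotDataOfK T'.D).choose_spec.2.1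
            (exists_realising_thetaIdeles_pilotDataOfK T'.D).choose_spec.1 (exists_realising_thetaIdeles_pilotDataOfK T'.D).choose_spec.2.2)
      · exact hNumOffBad P hP l hl h5 hc h2 h5' h6 hbad T' hS
    have hvol : Cor22.HullVolumeAtDatum P l
        (((l : ℝ) + 1) / 4 *
          ((1 + 12 * (Cor22.dmod P : ℝ) / l) * (P.logDiff + Cor22.logCondAvoid P {2, l})
            + 2 * Real.log l + 52
            + 20 / 3 * Real.log (((2 ^ 12 * 3 ^ 3 * 5 * Cor22.dmod P : ℕ) : ℝ) * (l : ℝ))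
              * (Nat.primeCounting (2 ^ 12 * 3 ^ 3 * 5 * Cor22.dmod P * l) : ℝ))) := by
      intro T'
      letI := T'.instFieldF; letI := T'.instNumberFieldF; letI := T'.instAlgebraF; letI := T'.instFieldK
      letI := T'.instNumberFieldK; letI := T'.instAlgebraK; letI := T'.instFieldFbar; letI := T'.instAlgebraFbar
      letI := T'.instAlgebraKFbar; letI := T'.instIsElliptic
      by_cases hcst : ∀ p ∈ T'.I.supportPrimes, ∀ v w : placesOver (fieldOfModuli T'.E) p,
          (Summit.ABC.IUTFork.DHData.ofInput T'.I).logQloc p v = (Summit.ABC.IUTFork.DHData.ofInput T'.I).logQloc p w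
      · -- slot-constant: abc-iut-S3's pinned junction, (R4) by abc-iut-S1 — NOTHING assumed
        exact PointDict.hullEstimateOf_BIII_pinned T' hP h7 (ThetaPartII.stub_R4 P hP l hl h5 hc h2 h5' h6 T') hcst
      · exact hregBad P hP l hl h5 hc h2 h5' h6 hbad T' hcst
    exact PointDict.logQAvoid_le_of_cor312AtDatum h312 hvol T hP.1
  by_cases hd : (Cor22.dmod P : ℝ) ≤ ((l : ℝ) + 5) / 4
  · by_cases hq : Cor22.logQAvoid P {2, l} ≤
        6 * l * (((l : ℝ) + 5) - 4 * Cor22.dmod P) / (((l : ℝ) + 4) * ((l : ℝ) - 3))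
            * (P.logDiff + (1 - 1 / (l : ℝ)) * Cor22.logCondAvoid P {2, l})
          + 6 * l * ((l : ℝ) + 5) / (((l : ℝ) + 4) * ((l : ℝ) - 3)) * Real.log Real.pi
    · -- SZPIRO-GOOD: the per-image Corollary is abc-iut-c312-d1's theorem (p449008), the per-image `B_III` estimate is PINNED (p448494) —
      -- NOTHING assumed, no hull-regime input
      exact PointDict.gap_le_BIII_of_cor312PerImageAtDatum hP h7 (Cor22.cor312PerImageAtDatum_of_szpiro hP.1 h5 hd hq) T
    · exact key (Or.inr (lt_of_not_ge hq))
  · exact key (Or.inl (lt_of_not_ge hd))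

end Summit.ABC.IUTFork.Conditional

end
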